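import Mathlib.Analysis.SpecialFunctions.Complex.Arg
import Mathlib.Analysis.SpecialFunctions.Trigonometric.Angle
import Mathlib.Data.Real.Sign
import Mathlib.Topology.Algebra.InfiniteSum.ENNReal
import Literature.Probability.LatticeModels.TriangularLatticeProofs
import Literature.Probability.RandomPlanarGeometry.TiltedExplorer
import HarnessLib

/-!
# The lattice imaginary-geometry (flow-line) harmonic functional of a hexagonal exploration prefix

Definition file (request `defn-latticeFlowLineHarmonic`, route CriticalPhenomena/SAWScalingLimit/
SAWTiltedExplorer, consumer `HarmonicWindingPassage` = stmt-CriticalPhenomena-8293 and the exact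
martingale item of `tiltedExplorerMeasure`; reusable by the cards imaginary-geometry-winding-dirichlet
and turn-defect-kernel-orthogonality). Companion of `TiltedExplorer.lean` (same topic), whose
vocabulary (`tiltedExplorerInitAngle`, `tiltedBankLeft/Right`, `triSubgraphMean`,
`IsTriHarmonicExtension`) it reuses.

## The object

Schramm–Sheffield's harmonic explorer (arXiv:math/0310210 = Ann. Probab. 33 (2005), §2) keeps the
value at every hexagon of the DISCRETE HARMONIC EXTENSION of the current boundary data an exact
martingale; "discrete harmonic" means six-neighbour means, i.e. the data are averaged against the
exit distribution of the simple random walk on the hexagons (sites of `𝕋`) absorbed on the determined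
hexagons. The route's tilted explorer (see `TiltedExplorer.lean`) replaces the `{0,1}` data by
Miller–Sheffield flow-line data (arXiv:1201.1496, Thm. 1.1 and Fig. 1.10: `∓λ' + χ · winding` on the
two banks of the curve, here in the normalisation gap `g` ↔ `λ'`, tilt `c` ↔ `(π/3) χ`): a hexagon
passed by the exploration path carries `c · k ∓ g`, `k` the unwrapped tangent angle of the passing
dart in units of `π/3` (measured from the vertical), `-` on the LEFT bank, `+` on the RIGHT bank.

Given discrete Dobrushin data `E` (hexagons = sites of `δ𝕋`, `Ω_δ = triDiscreteDomainGraph E.Ω E.δ`),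
arc data `β`, tilt `c`, gap `g`, a face sequence `P : ℕ → HexVertex` (the faces `f_0, f_1, …` of a
self-avoiding honeycomb walk, e.g. `(explorationWalk E ω).getVert`; dart `i` is `f_i → f_{i+1}`), a
time `n` (darts `i < n` have been performed) and a hexagon `ζ`,

  `latticeFlowLineHarmonic E β c g n P ζ = ∑_u hm(ζ, u) · data(u)`,
  `hm(ζ, u) = ∑_{p : ζ → u walk of Ω_δ, u ∈ S, p ∩ S = {u} before its end} (1/6)^{|p|}`,

with the ABSORBING SET `S = E.triArcA ∪ E.triArcB ∪ {hexagons passed by the darts i < n}` (a hexagon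
is passed by dart `i` iff it is an endpoint of the crossed edge
`hexFaceVertices (P i) ∩ hexFaceVertices (P (i+1))`) and the DATA `β` on the arcs and, on a bank
hexagon `u` first passed by the dart `i₀ = firstPassage P u`,

* variant (a), FIRST-PASSAGE rule (`latticeFlowLineData`, the exact martingale data of
  `tiltedExplorerMeasure`): `c (A_{i₀} - π/2)/(π/3) ∓ g`, `A_i = A_0 + (π/3) ∑_{j=1}^{i} turn_j` the
  unwrapped angle of dart `i` (`hexPathTurn`: `turn_j = sign Im ((c_{j+1} - c_j) conj (c_j - c_{j-1}))`,
  `c_j = hexCenter (P j)`; `A_0 = tiltedExplorerInitAngle β (P 0) (P 1)`, the branch of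
  `arg (c_1 - c_0)` anchored on `π (β x_a + β y_b)/2 + π/2`), sign `-` iff `u` is on the LEFT of the
  dart `i₀` (`IsLeftOfDart`, the side convention of `IsExplorationStep`);
* variant (b), MESOSCOPIC-WINDOW rule (`latticeFlowLineWindowData`, texture-free, for
  `HarmonicWindingPassage`): the same with `A_{i₀}` replaced by `Â_m(i₀)`, the unwrapped angle of the
  DISPLACEMENT `c_{i+1} - c_{i+1-m}` over the window of `m` darts ending with dart `i`
  (`windowAngle`: the raw angle at `i = 0` anchored in the same gauge, plus the principal values of
  the increments of consecutive raw window angles); `latticeFlowLineHarmonicWindow E β c g m n P ζ`.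

## Contents and what is proved

* `IsFirstHitWalk`, `triHitKernel G S ζ u` (the walk sum `hm`, a real `tsum`), `triHitExtension`;
  the same kernel in `ℝ≥0∞` (`triHitKernelENN`, `hitWt`) with the FIRST-STEP DECOMPOSITION
  (`tsum_hitWt_eq_of_not_mem`, by the bijection `consWalk` "first step, rest of the walk") and the
  SUB-PROBABILITY BOUND `∑_u hm(ζ,u) ≤ 1` for `G ≤ 𝕋` (`tsum_triHitKernelENN_le_one`: induction on
  the length truncation, six neighbours), whence `triHitKernel_eq_toReal`, summability, and:
* boundary values `hm(ζ, ·) = δ_ζ` on `S` (`triHitKernel_self_of_mem`, `triHitExtension_of_mem`);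
  HARMONICITY off `S`: `triHitKernel_of_not_mem`, `triHitExtension_of_not_mem` (`H ζ` is the
  `triSubgraphMean` of `TiltedExplorer.lean`), packaged as
  `isTriHarmonicExtension_triHitExtension : IsTriHarmonicExtension G Sᶜ data H`;
  BOUNDEDNESS `|H| ≤ max_S |data|` (`abs_triHitExtension_le`); MONOTONICITY of harmonic measure under
  enlarging `S` (`triHitKernel_anti`); linearity in the data (`triHitExtension_sub`);
* the path geometry `passedHexagons`, `firstPassage`, `IsLeftOfDart`, `hexPathTurn`, `gaugeAnchor`,
  `dartAngle`, `windowRawAngle`, `windowAngle` with their recursions (`dartAngle_succ`,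
  `windowAngle_succ`, `abs_windowAngle_succ_sub_le`, `windowAngle_zero_of_pos`,
  `passedHexagons_succ`, `firstPassage_spec`);
* the two data and the two functionals, with: values on the absorbing set
  (`latticeFlowLineHarmonic_of_mem`, `…_of_mem_arcs`), harmonicity off it
  (`latticeFlowLineHarmonic_of_not_mem`, `isTriHarmonicExtension_latticeFlowLineHarmonic[Window]`,
  for `β` bounded on the arcs), boundedness (`abs_latticeFlowLineHarmonic[Window]_le`), monotonicity
  of the arcs' harmonic measure as banks are added (`triHitKernel_flowLineAbsorbing_anti`), agreement
  of (a) and (b) up to the window correction (`latticeFlowLineWindowData_sub`,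
  `latticeFlowLineHarmonicWindow_sub`), and consistency with the frozen bank values of
  `TiltedExplorer.lean` (`latticeFlowLineData_eq_tiltedBankLeft/Right`).

## Design choices and junk values

* The kernel is a walk sum (not the solution of a linear system as `triHarmonicExtension` of
  `TiltedExplorer.lean`): no uniqueness junk; for finite undetermined sets both agree (not proved
  here). Killed mass (walk leaving `Ω_δ`, or never absorbed) counts `0`; from `ζ ∈ S` the kernel is
  `δ_ζ`; hexagons outside `Ω_δ` are isolated in `Ω_δ`, so `H ζ = 0` there unless `ζ ∈ S`.
* `firstPassage` is an `sInf` (junk `0` for never-passed hexagons, never read: the data of a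
  non-absorbing hexagon do not enter `H`); `hexPathTurn P 0 = 0` and `windowRawAngle` uses a shorter
  window while `i + 1 < m` (`ℕ`-subtraction); `P` is read beyond `n` only through `P n` (the tip face)
  — for `P = γ.getVert` and `n ≤ γ.length` everything is intrinsic to the prefix.
* The one-step update formula when a hexagon is added to `S` (strong Markov property at its hitting
  time; Schramm–Sheffield's first-step decomposition, Lemma of §2/§4) and the agreement
  `Â_1 = A` for honeycomb paths are NOT proved here (no named facts are introduced, D-0026).

## References

* O. Schramm, S. Sheffield, *Harmonic explorer and its convergence to SLE₄*, Ann. Probab. 33 (2005)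
  2127–2148 = arXiv:math/0310210, §2 (HE, discrete harmonic extension), §3–4. [SchrammSheffield2005]
* J. Miller, S. Sheffield, *Imaginary geometry I*, PTRF 164 (2016) = arXiv:1201.1496, Thm. 1.1,
  Fig. 1.10 (flow-line boundary values `∓λ' + χ · winding`). [MillerSheffield2016]
* D. Chelkak, *Robust discrete complex analysis: a toolbox*, Ann. Probab. 44 (2016) =
  arXiv:1212.6205 (discrete harmonic measure via random-walk partition functions). [Chelkak2016]
* S. Smirnov, C. R. Acad. Sci. 333 (2001), §2 (hexagonal exploration of `Ω_δ`). [Smirnov2001]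
-/

noncomputable section

open Finset
open scoped ENNReal

namespace Literature.Probability.RandomPlanarGeometry

open Literature.Probability.LatticeModels Literature.Probability.Percolation

/-! ### First-hit kernel of the six-neighbour walk along a subgraph of `𝕋`, absorbed on a set -/

/-- A walk `p : ζ → u` of `G` is a *first-hit walk* for the absorbing set `S`: its endpoint `u` lies in
`S` and all its earlier vertices `p_0 = ζ, …, p_{ℓ-1}` lie outside `S`. [folklore] -/
def IsFirstHitWalk {G : SimpleGraph (Site 2)} (S : Set (Site 2)) {ζ u : Site 2} (p : G.Walk ζ u) :
    Prop :=
  u ∈ S ∧ ∀ i < p.length, p.getVert i ∉ S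

open scoped Classical in
/-- **The first-hit (harmonic-measure) kernel** of the simple random walk of `𝕋` run along the
subgraph `G` and absorbed on `S`:
`hm_G^S(ζ, u) = ∑_{p : ζ → u walk of G, u ∈ S, p avoids S before u} (1/6)^{length p}` — the
probability that the walk started at `ζ` which at each step picks one of its six `𝕋`-neighbours
uniformly and is killed unless the step is an edge of `G` (for `G = Ω_δ`: killed when it tries to
leave the discrete domain) is absorbed in `S` and enters `S` at `u`. [folklore] -/
def triHitKernel (G : SimpleGraph (Site 2)) (S : Set (Site 2)) (ζ u : Site 2) : ℝ :=
  ∑' p : G.Walk ζ u, if IsFirstHitWalk S p then (1 / 6 : ℝ) ^ p.length else 0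

/-- **The absorbed harmonic extension** `H(ζ) = ∑_u hm_G^S(ζ, u) · data(u)` of `data|_S` along `G`:
the expected value of `data` at the absorption point (killed mass counts `0`). [folklore] -/
def triHitExtension (G : SimpleGraph (Site 2)) (S : Set (Site 2)) (data : Site 2 → ℝ)
    (ζ : Site 2) : ℝ :=
  ∑' u : Site 2, triHitKernel G S ζ u * data u

/-! ### The kernel in `ℝ≥0∞`: first-hit walks, first-step decomposition, total mass `≤ 1` -/

section Kernel

open SimpleGraph

variable {G : SimpleGraph (Site 2)} {S : Set (Site 2)} {ζ ζ' u : Site 2}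

/-- The nil walk is a first-hit walk iff its vertex is absorbing. [folklore] -/
theorem isFirstHitWalk_nil_iff : IsFirstHitWalk S (Walk.nil : G.Walk ζ ζ) ↔ ζ ∈ S := by
  simp [IsFirstHitWalk]

/-- A walk `ζ → ζ' → ⋯ → u` is a first-hit walk iff `ζ` is not absorbing and its tail is a
first-hit walk. [folklore] -/
theorem isFirstHitWalk_cons_iff (h : G.Adj ζ ζ') (q : G.Walk ζ' u) :
    IsFirstHitWalk S (Walk.cons h q) ↔ ζ ∉ S ∧ IsFirstHitWalk S q := by
  simp only [IsFirstHitWalk, Walk.length_cons]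
  constructor
  · rintro ⟨hu, hall⟩
    refine ⟨?_, hu, fun i hi => ?_⟩
    · simpa using hall 0 (Nat.succ_pos _)
    · simpa [Walk.getVert_cons_succ] using hall (i + 1) (by omega)
  · rintro ⟨hζ, hu, hall⟩
    refine ⟨hu, fun i hi => ?_⟩
    cases i with
    | zero => simpa using hζ
    | succ i => simpa [Walk.getVert_cons_succ] using hall i (by omega)

/-- A first-hit walk started inside the absorbing set is trivial. [folklore] -/
theorem IsFirstHitWalk.length_eq_zero {p : G.Walk ζ u} (hp : IsFirstHitWalk S p) (hζ : ζ ∈ S) :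
    p.length = 0 := by
  by_contra h
  exact hp.2 0 (Nat.pos_of_ne_zero h) (by simpa using hζ)

/-- A first-hit walk started inside the absorbing set is the nil walk. [folklore] -/
theorem IsFirstHitWalk.eq_nil {p : G.Walk ζ ζ} (hp : IsFirstHitWalk S p) (hζ : ζ ∈ S) :
    p = Walk.nil :=
  Walk.eq_nil_iff_nil.2 (Walk.length_eq_zero_iff.1 (hp.length_eq_zero hζ))

/-- First-hit walks for a larger absorbing set ending in the smaller one are first-hit walks for
the smaller one. [folklore] -/
theorem IsFirstHitWalk.mono {S' : Set (Site 2)} {p : G.Walk ζ u} (hp : IsFirstHitWalk S' p)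
    (hSS' : S ⊆ S') (hu : u ∈ S) : IsFirstHitWalk S p :=
  ⟨hu, fun i hi hi' => hp.2 i hi (hSS' hi')⟩

open scoped Classical in
/-- The weight `(1/6)^{length}` of a first-hit walk whose length satisfies the constraint `c`
(`0` otherwise), in `ℝ≥0∞`; `c = ⊤` gives the kernel, `c = (· ≤ N)` its truncations. [folklore] -/
def hitWt (S : Set (Site 2)) (c : ℕ → Prop) {ζ u : Site 2} (p : G.Walk ζ u) : ℝ≥0∞ :=
  if IsFirstHitWalk S p ∧ c p.length then (6⁻¹ : ℝ≥0∞) ^ p.length else 0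

/-- `hitWt` only depends on the constraint at the walk's length. [folklore] -/
theorem hitWt_congr {c c' : ℕ → Prop} (p : G.Walk ζ u) (h : c p.length ↔ c' p.length) :
    hitWt S c p = hitWt S c' p := by
  unfold hitWt
  split_ifs with h1 h2 h2
  · rfl
  · exact absurd ⟨h1.1, h.1 h1.2⟩ h2
  · exact absurd ⟨h2.1, h.2 h2.2⟩ h1
  · rfl

/-- `hitWt ≤ 1`. [folklore] -/
theorem hitWt_le_one {c : ℕ → Prop} (p : G.Walk ζ u) : hitWt S c p ≤ 1 := by
  unfold hitWt
  split_ifs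
  · exact pow_le_one₀ bot_le (ENNReal.inv_le_one.2 (by norm_num))
  · exact bot_le

/-- The nil walk at a non-absorbing site has weight `0`. [folklore] -/
theorem hitWt_eq_zero_of_nil {c : ℕ → Prop} {p : G.Walk ζ u} (hp : p.Nil) (hζ : ζ ∉ S) :
    hitWt S c p = 0 := by
  unfold hitWt
  rw [if_neg]
  rintro ⟨hfh, -⟩
  cases hp
  exact hζ (isFirstHitWalk_nil_iff.1 hfh)

/-- A non-nil walk from an absorbing site has weight `0`. [folklore] -/
theorem hitWt_eq_zero_of_mem {c : ℕ → Prop} {p : G.Walk ζ u} (hζ : ζ ∈ S) (hp : ¬ p.Nil) :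
    hitWt S c p = 0 := by
  unfold hitWt
  rw [if_neg]
  rintro ⟨hfh, -⟩
  exact hp (Walk.length_eq_zero_iff.1 (hfh.length_eq_zero hζ))

open scoped Classical in
/-- **The first-hit kernel in `ℝ≥0∞`** (same walk sum as `triHitKernel`). [folklore] -/
def triHitKernelENN (G : SimpleGraph (Site 2)) (S : Set (Site 2)) (ζ u : Site 2) : ℝ≥0∞ :=
  ∑' p : G.Walk ζ u, if IsFirstHitWalk S p then (6⁻¹ : ℝ≥0∞) ^ p.length else 0

/-- The kernel is the walk sum of `hitWt` with no length constraint. [folklore] -/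
theorem triHitKernelENN_eq_tsum_hitWt :
    triHitKernelENN G S ζ u = ∑' p : G.Walk ζ u, hitWt S (fun _ => True) p := by
  classical
  simp [triHitKernelENN, hitWt]

/-- Prefixing a walk from a `G`-neighbour of `ζ` with the first step `ζ → ζ'`. [folklore] -/
def consWalk (G : SimpleGraph (Site 2)) (ζ u : Site 2)
    (x : Σ ζ' : G.neighborSet ζ, G.Walk (ζ' : Site 2) u) : G.Walk ζ u :=
  Walk.cons x.1.2 x.2

/-- `consWalk` is injective. [folklore] -/
theorem consWalk_injective : Function.Injective (consWalk G ζ u) := by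
  rintro ⟨⟨a, ha⟩, p⟩ ⟨⟨b, hb⟩, q⟩ h
  have h' : (Walk.cons ha p : G.Walk ζ u) = Walk.cons hb q := h
  rw [Walk.cons.injEq] at h'
  obtain ⟨rfl, hpq⟩ := h'
  rw [eq_of_heq hpq]

/-- Every non-trivial walk is a `consWalk`. [folklore] -/
theorem mem_range_consWalk_of_not_nil {p : G.Walk ζ u} (hp : ¬ p.Nil) :
    p ∈ Set.range (consWalk G ζ u) := by
  cases p with
  | nil => exact absurd Walk.Nil.nil hp
  | cons h q => exact ⟨⟨⟨_, h⟩, q⟩, rfl⟩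

open scoped Classical in
/-- **First-step decomposition** of the constrained walk sums at a non-absorbing site `ζ`, along a
subgraph `G` of `𝕋`: split a walk after its first step. [folklore] -/
theorem tsum_hitWt_eq_of_not_mem (hG : G ≤ triGraph) (c : ℕ → Prop) (hζ : ζ ∉ S) (u : Site 2) :
    ∑' p : G.Walk ζ u, hitWt S c p =
      6⁻¹ * ∑ ζ' ∈ (triGraph.neighborFinset ζ).filter (G.Adj ζ ·),
        ∑' q : G.Walk ζ' u, hitWt S (fun n => c (n + 1)) q := by
  have hsupp : Function.support (fun p : G.Walk ζ u => hitWt S c p) ⊆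
      Set.range (consWalk G ζ u) := by
    intro p hp
    refine mem_range_consWalk_of_not_nil fun hnil => ?_
    rw [Function.mem_support] at hp
    exact hp (hitWt_eq_zero_of_nil hnil hζ)
  rw [← consWalk_injective.tsum_eq hsupp, ENNReal.tsum_sigma']
  have hcons : ∀ (x : G.neighborSet ζ) (q : G.Walk (x : Site 2) u),
      hitWt S c (consWalk G ζ u ⟨x, q⟩) = 6⁻¹ * hitWt S (fun n => c (n + 1)) q := by
    intro x q
    show hitWt S c (Walk.cons x.2 q) = _
    unfold hitWt
    rw [Walk.length_cons]
    by_cases hq : IsFirstHitWalk S q ∧ c (q.length + 1)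
    · rw [if_pos ⟨(isFirstHitWalk_cons_iff x.2 q).2 ⟨hζ, hq.1⟩, hq.2⟩, if_pos hq, pow_succ,
        mul_comm]
    · rw [if_neg (fun h => hq ⟨((isFirstHitWalk_cons_iff x.2 q).1 h.1).2, h.2⟩), if_neg hq,
        mul_zero]
  simp_rw [hcons, ENNReal.tsum_mul_left]
  -- `congr 1` would try `rfl` on `tsum`s and time out; peel the factor explicitly
  refine congrArg (6⁻¹ * ·) ?_
  rw [tsum_subtype (G.neighborSet ζ) (fun ζ' => ∑' q : G.Walk ζ' u, hitWt S (fun n => c (n + 1)) q),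
    tsum_eq_sum' (s := (triGraph.neighborFinset ζ).filter (G.Adj ζ ·))]
  · refine Finset.sum_congr rfl fun ζ' hζ' => ?_
    rw [Finset.mem_filter] at hζ'
    exact Set.indicator_of_mem (by simpa using hζ'.2) _
  · intro ζ' hζ'
    rw [Function.mem_support, Set.indicator_apply_ne_zero] at hζ'
    have hadj : G.Adj ζ ζ' := by simpa using hζ'.1
    simp only [Finset.coe_filter, Set.mem_setOf_eq, SimpleGraph.mem_neighborFinset]
    exact ⟨hG hadj, hadj⟩

open scoped Classical in
/-- At a non-absorbing site the kernel is the six-neighbour `G`-mean of the kernel (first-step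
decomposition). [folklore] -/
theorem triHitKernelENN_of_not_mem (hG : G ≤ triGraph) (hζ : ζ ∉ S) (u : Site 2) :
    triHitKernelENN G S ζ u =
      6⁻¹ * ∑ ζ' ∈ (triGraph.neighborFinset ζ).filter (G.Adj ζ ·), triHitKernelENN G S ζ' u := by
  simp only [triHitKernelENN_eq_tsum_hitWt]
  exact tsum_hitWt_eq_of_not_mem hG _ hζ u

/-- Inside the absorbing set only the trivial walk counts: the walk sums from `ζ ∈ S` to `u ≠ ζ`
vanish. [folklore] -/
theorem tsum_hitWt_of_mem_of_ne (c : ℕ → Prop) (hζ : ζ ∈ S) (hu : u ≠ ζ) :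
    ∑' p : G.Walk ζ u, hitWt S c p = 0 :=
  ENNReal.tsum_eq_zero.2 fun _ => hitWt_eq_zero_of_mem hζ (Walk.not_nil_of_ne hu.symm)

/-- Inside the absorbing set only the trivial walk counts: the walk sum from `ζ ∈ S` to itself is
the weight of the nil walk, at most `1`. [folklore] -/
theorem tsum_hitWt_self_le_one (c : ℕ → Prop) (hζ : ζ ∈ S) :
    ∑' p : G.Walk ζ ζ, hitWt S c p ≤ 1 := by
  rw [tsum_eq_single (Walk.nil : G.Walk ζ ζ)]
  · exact hitWt_le_one _
  · intro p hp
    exact hitWt_eq_zero_of_mem hζ fun h => hp (Walk.eq_nil_iff_nil.2 h)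

/-- The total mass of the walk sums started inside the absorbing set is at most `1`. [folklore] -/
theorem tsum_tsum_hitWt_le_one_of_mem (c : ℕ → Prop) (hζ : ζ ∈ S) :
    ∑' u, ∑' p : G.Walk ζ u, hitWt S c p ≤ 1 := by
  rw [tsum_eq_single ζ fun u hu => tsum_hitWt_of_mem_of_ne c hζ hu]
  exact tsum_hitWt_self_le_one c hζ

/-- A site of `𝕋` has at most six `G`-neighbours. [folklore] -/
theorem card_filter_adj_le_six (ζ : Site 2) [DecidablePred (G.Adj ζ ·)] :
    ((triGraph.neighborFinset ζ).filter (G.Adj ζ ·)).card ≤ 6 :=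
  (Finset.card_filter_le _ _).trans (card_neighborFinset_triGraph_holds ζ).le

/-- **Sub-probability of the truncated kernels**: walks of length `≤ N` carry total first-hit mass
at most `1` (induction on `N` by the first-step decomposition; every site of `𝕋` has six
neighbours). [folklore] -/
theorem tsum_tsum_hitWt_le_one (hG : G ≤ triGraph) :
    ∀ (N : ℕ) (ζ : Site 2), ∑' u, ∑' p : G.Walk ζ u, hitWt S (· ≤ N) p ≤ 1 := by
  classical
  intro N
  induction N with
  | zero =>
    intro ζ
    by_cases hζ : ζ ∈ S
    · exact tsum_tsum_hitWt_le_one_of_mem _ hζ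
    · refine le_of_eq_of_le (ENNReal.tsum_eq_zero.2 fun u => ENNReal.tsum_eq_zero.2 fun p => ?_)
        zero_le_one
      by_cases hp : p.Nil
      · exact hitWt_eq_zero_of_nil hp hζ
      · unfold hitWt
        rw [if_neg]
        rintro ⟨-, h0⟩
        exact hp (Walk.length_eq_zero_iff.1 (Nat.le_zero.1 h0))
  | succ N ih =>
    intro ζ
    by_cases hζ : ζ ∈ S
    · exact tsum_tsum_hitWt_le_one_of_mem _ hζ
    · set F := (triGraph.neighborFinset ζ).filter (G.Adj ζ ·) with hF
      have hdec : ∀ u, ∑' p : G.Walk ζ u, hitWt S (· ≤ N + 1) p =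
          6⁻¹ * ∑ ζ' ∈ F, ∑' q : G.Walk ζ' u, hitWt S (· ≤ N) q := by
        intro u
        rw [tsum_hitWt_eq_of_not_mem hG _ hζ u]
        simp only [Nat.add_le_add_iff_right, hF]
      rw [tsum_congr hdec, ENNReal.tsum_mul_left,
        Summable.tsum_finsetSum fun _ _ => ENNReal.summable]
      have h6 : ∑ ζ' ∈ F, (1 : ℝ≥0∞) ≤ 6 := by
        rw [Finset.sum_const, nsmul_one]
        exact_mod_cast card_filter_adj_le_six ζ
      calc (6⁻¹ : ℝ≥0∞) * ∑ ζ' ∈ F, ∑' u, ∑' q : G.Walk ζ' u, hitWt S (· ≤ N) q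
          ≤ 6⁻¹ * ∑ ζ' ∈ F, (1 : ℝ≥0∞) :=
            mul_le_mul_right (Finset.sum_le_sum fun ζ' _ => ih ζ') _
        _ ≤ 6⁻¹ * 6 := mul_le_mul_right h6 _
        _ = 1 := ENNReal.inv_mul_cancel (by norm_num) (by simp)

/-- **The first-hit kernel is a sub-probability**: `∑_u hm_G^S(ζ, u) ≤ 1` for `G ≤ 𝕋`. [folklore] -/
theorem tsum_triHitKernelENN_le_one (hG : G ≤ triGraph) (ζ : Site 2) :
    ∑' u, triHitKernelENN G S ζ u ≤ 1 := by
  classical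
  simp only [triHitKernelENN_eq_tsum_hitWt]
  have hσ := ENNReal.tsum_sigma'
    (fun x : (Σ u : Site 2, G.Walk ζ u) => hitWt S (fun _ => True) x.2)
  simp only at hσ
  rw [← hσ, ENNReal.tsum_eq_iSup_sum]
  refine iSup_le fun s => ?_
  set N : ℕ := s.sup fun x => x.2.length with hN
  calc ∑ x ∈ s, hitWt S (fun _ => True) x.2 = ∑ x ∈ s, hitWt S (· ≤ N) x.2 := by
        refine Finset.sum_congr rfl fun x hx => hitWt_congr _ ?_
        simp only [true_iff]
        exact Finset.le_sup (f := fun x : (Σ u : Site 2, G.Walk ζ u) => x.2.length) hx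
    _ ≤ ∑' x : (Σ u : Site 2, G.Walk ζ u), hitWt S (· ≤ N) x.2 := ENNReal.sum_le_tsum s
    _ = ∑' u, ∑' p : G.Walk ζ u, hitWt S (· ≤ N) p := by
        have h := ENNReal.tsum_sigma'
          (fun x : (Σ u : Site 2, G.Walk ζ u) => hitWt S (· ≤ N) x.2)
        simpa using h
    _ ≤ 1 := tsum_tsum_hitWt_le_one hG N ζ

/-- Each kernel entry is at most `1`. [folklore] -/
theorem triHitKernelENN_le_one (hG : G ≤ triGraph) : triHitKernelENN G S ζ u ≤ 1 :=
  (ENNReal.le_tsum u).trans (tsum_triHitKernelENN_le_one hG ζ)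

/-- Each kernel entry is finite. [folklore] -/
theorem triHitKernelENN_ne_top (hG : G ≤ triGraph) : triHitKernelENN G S ζ u ≠ ∞ :=
  ne_top_of_le_ne_top ENNReal.one_ne_top (triHitKernelENN_le_one hG)

/-- The total mass is finite. [folklore] -/
theorem tsum_triHitKernelENN_ne_top (hG : G ≤ triGraph) : ∑' u, triHitKernelENN G S ζ u ≠ ∞ :=
  ne_top_of_le_ne_top ENNReal.one_ne_top (tsum_triHitKernelENN_le_one hG ζ)

/-- From an absorbing site the kernel is the point mass: `hm(ζ, ζ) = 1` for `ζ ∈ S`. [folklore] -/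
theorem triHitKernelENN_self_of_mem (hζ : ζ ∈ S) : triHitKernelENN G S ζ ζ = 1 := by
  classical
  rw [triHitKernelENN_eq_tsum_hitWt, tsum_eq_single (Walk.nil : G.Walk ζ ζ)]
  · simp [hitWt, isFirstHitWalk_nil_iff, hζ]
  · intro p hp
    exact hitWt_eq_zero_of_mem hζ fun h => hp (Walk.eq_nil_iff_nil.2 h)

/-- From an absorbing site the kernel is the point mass: `hm(ζ, u) = 0` for `ζ ∈ S`, `u ≠ ζ`.
[folklore] -/
theorem triHitKernelENN_of_mem_of_ne (hζ : ζ ∈ S) (hu : u ≠ ζ) : triHitKernelENN G S ζ u = 0 := by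
  rw [triHitKernelENN_eq_tsum_hitWt]
  exact tsum_hitWt_of_mem_of_ne _ hζ hu

/-- The kernel only charges the absorbing set. [folklore] -/
theorem triHitKernelENN_of_not_mem_target (hu : u ∉ S) : triHitKernelENN G S ζ u = 0 := by
  refine ENNReal.tsum_eq_zero.2 fun p => ?_
  rw [if_neg]
  exact fun h => hu h.1

/-- **Monotonicity in the absorbing set**: enlarging `S` can only decrease the harmonic measure
of a site of `S` (more walks are absorbed earlier). [folklore] -/
theorem triHitKernelENN_anti {S' : Set (Site 2)} (hSS' : S ⊆ S') (hu : u ∈ S) :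
    triHitKernelENN G S' ζ u ≤ triHitKernelENN G S ζ u := by
  classical
  refine ENNReal.tsum_le_tsum fun p => ?_
  split_ifs with h1 h2
  · exact le_rfl
  · exact absurd (h1.mono hSS' hu) h2
  · exact bot_le
  · exact le_rfl

end Kernel

/-! ### The real kernel: sub-probability, boundary values, harmonicity, monotonicity -/

section RealKernel

open SimpleGraph

variable {G : SimpleGraph (Site 2)} {S : Set (Site 2)} {ζ u : Site 2}

/-- The real kernel is the real part of the `ℝ≥0∞` kernel (all terms are finite). [folklore] -/
theorem triHitKernel_eq_toReal : triHitKernel G S ζ u = (triHitKernelENN G S ζ u).toReal := by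
  classical
  unfold triHitKernel triHitKernelENN
  rw [ENNReal.tsum_toReal_eq]
  · refine tsum_congr fun p => ?_
    split_ifs
    · simp [ENNReal.toReal_pow, ENNReal.toReal_inv, one_div]
    · simp
  · intro p
    split_ifs
    · exact ENNReal.pow_ne_top (ENNReal.inv_ne_top.2 (by norm_num))
    · exact ENNReal.zero_ne_top

/-- `hm(ζ, u) ≥ 0`. [folklore] -/
theorem triHitKernel_nonneg : 0 ≤ triHitKernel G S ζ u := by
  rw [triHitKernel_eq_toReal]; exact ENNReal.toReal_nonneg

/-- `hm(ζ, u) ≤ 1` along a subgraph of `𝕋`. [folklore] -/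
theorem triHitKernel_le_one (hG : G ≤ triGraph) : triHitKernel G S ζ u ≤ 1 := by
  rw [triHitKernel_eq_toReal]
  exact ENNReal.toReal_le_of_le_ofReal zero_le_one (by simpa using triHitKernelENN_le_one hG)

/-- `u ↦ hm(ζ, u)` is summable along a subgraph of `𝕋`. [folklore] -/
theorem summable_triHitKernel (hG : G ≤ triGraph) (ζ : Site 2) :
    Summable fun u => triHitKernel G S ζ u := by
  simp_rw [triHitKernel_eq_toReal]
  exact ENNReal.summable_toReal (tsum_triHitKernelENN_ne_top hG)

/-- **Sub-probability**: `∑_u hm(ζ, u) ≤ 1` along a subgraph of `𝕋` (killed mass is lost). [folklore] -/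
theorem tsum_triHitKernel_le_one (hG : G ≤ triGraph) (ζ : Site 2) :
    ∑' u, triHitKernel G S ζ u ≤ 1 := by
  simp_rw [triHitKernel_eq_toReal]
  rw [← ENNReal.tsum_toReal_eq fun u => triHitKernelENN_ne_top hG]
  exact ENNReal.toReal_le_of_le_ofReal zero_le_one (by simpa using tsum_triHitKernelENN_le_one hG ζ)

/-- **Boundary values of the kernel**: `hm(ζ, ζ) = 1` for `ζ ∈ S`. [folklore] -/
theorem triHitKernel_self_of_mem (hζ : ζ ∈ S) : triHitKernel G S ζ ζ = 1 := by
  rw [triHitKernel_eq_toReal, triHitKernelENN_self_of_mem hζ, ENNReal.toReal_one]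

/-- **Boundary values of the kernel**: `hm(ζ, u) = 0` for `ζ ∈ S`, `u ≠ ζ`. [folklore] -/
theorem triHitKernel_of_mem_of_ne (hζ : ζ ∈ S) (hu : u ≠ ζ) : triHitKernel G S ζ u = 0 := by
  rw [triHitKernel_eq_toReal, triHitKernelENN_of_mem_of_ne hζ hu, ENNReal.toReal_zero]

/-- The kernel only charges the absorbing set. [folklore] -/
theorem triHitKernel_of_not_mem_target (hu : u ∉ S) : triHitKernel G S ζ u = 0 := by
  rw [triHitKernel_eq_toReal, triHitKernelENN_of_not_mem_target hu, ENNReal.toReal_zero]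

/-- **Monotonicity of harmonic measure under enlarging the absorbing set** (e.g. adding bank
hexagons to the arcs): `hm_G^{S'}(ζ, u) ≤ hm_G^S(ζ, u)` for `u ∈ S ⊆ S'`. [folklore] -/
theorem triHitKernel_anti (hG : G ≤ triGraph) {S' : Set (Site 2)} (hSS' : S ⊆ S') (hu : u ∈ S) :
    triHitKernel G S' ζ u ≤ triHitKernel G S ζ u := by
  rw [triHitKernel_eq_toReal, triHitKernel_eq_toReal]
  exact ENNReal.toReal_mono (triHitKernelENN_ne_top hG) (triHitKernelENN_anti hSS' hu)

open scoped Classical in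
/-- **First-step (harmonicity) identity of the kernel** off the absorbing set:
`hm(ζ, u) = (1/6) ∑_{ζ' ∼_𝕋 ζ, G.Adj ζ ζ'} hm(ζ', u)` for `ζ ∉ S`. [folklore] -/
theorem triHitKernel_of_not_mem (hG : G ≤ triGraph) (hζ : ζ ∉ S) (u : Site 2) :
    triHitKernel G S ζ u = (1 / 6 : ℝ) * ∑ ζ' ∈ triGraph.neighborFinset ζ,
      if G.Adj ζ ζ' then triHitKernel G S ζ' u else 0 := by
  rw [triHitKernel_eq_toReal, triHitKernelENN_of_not_mem hG hζ u, ENNReal.toReal_mul,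
    ENNReal.toReal_sum (fun ζ' _ => triHitKernelENN_ne_top hG), Finset.sum_filter]
  simp only [triHitKernel_eq_toReal, ENNReal.toReal_inv, ENNReal.toReal_ofNat, one_div]

/-- **Boundary values**: on the absorbing set the extension is the data, `H(ζ) = data(ζ)`. [folklore] -/
theorem triHitExtension_of_mem (data : Site 2 → ℝ) (hζ : ζ ∈ S) :
    triHitExtension G S data ζ = data ζ := by
  unfold triHitExtension
  rw [tsum_eq_single ζ]
  · rw [triHitKernel_self_of_mem hζ, one_mul]
  · intro u hu
    rw [triHitKernel_of_mem_of_ne hζ hu, zero_mul]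

/-- Termwise bound `|hm(ζ, u) data(u)| ≤ hm(ζ, u) M` for data bounded by `M` on `S`. [folklore] -/
theorem abs_triHitKernel_mul_le {data : Site 2 → ℝ} {M : ℝ} (hM : ∀ u ∈ S, |data u| ≤ M)
    (ζ u : Site 2) : |triHitKernel G S ζ u * data u| ≤ triHitKernel G S ζ u * M := by
  rw [abs_mul, abs_of_nonneg triHitKernel_nonneg]
  by_cases hu : u ∈ S
  · exact mul_le_mul_of_nonneg_left (hM u hu) triHitKernel_nonneg
  · rw [triHitKernel_of_not_mem_target hu, zero_mul, zero_mul]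

/-- The summands of the extension are summable for data bounded on `S`. [folklore] -/
theorem summable_triHitKernel_mul (hG : G ≤ triGraph) {data : Site 2 → ℝ} {M : ℝ}
    (hM : ∀ u ∈ S, |data u| ≤ M) (ζ : Site 2) :
    Summable fun u => triHitKernel G S ζ u * data u :=
  Summable.of_norm_bounded ((summable_triHitKernel hG ζ).mul_right M) fun u => by
    rw [Real.norm_eq_abs]; exact abs_triHitKernel_mul_le hM ζ u

/-- **Boundedness by `max |data|`**: `|H(ζ)| ≤ M` if `|data| ≤ M` on the absorbing set. [folklore] -/
theorem abs_triHitExtension_le (hG : G ≤ triGraph) {data : Site 2 → ℝ} {M : ℝ} (hM0 : 0 ≤ M)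
    (hM : ∀ u ∈ S, |data u| ≤ M) (ζ : Site 2) : |triHitExtension G S data ζ| ≤ M := by
  have hs := summable_triHitKernel_mul hG hM ζ
  unfold triHitExtension
  calc |∑' u, triHitKernel G S ζ u * data u|
      ≤ ∑' u, |triHitKernel G S ζ u * data u| := by
        have h := norm_tsum_le_tsum_norm hs.norm
        simpa only [Real.norm_eq_abs] using h
    _ ≤ ∑' u, triHitKernel G S ζ u * M :=
        Summable.tsum_le_tsum (abs_triHitKernel_mul_le hM ζ) hs.abs
          ((summable_triHitKernel hG ζ).mul_right M)
    _ = (∑' u, triHitKernel G S ζ u) * M := tsum_mul_right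
    _ ≤ 1 * M := mul_le_mul_of_nonneg_right (tsum_triHitKernel_le_one hG ζ) hM0
    _ = M := one_mul M

open scoped Classical in
/-- **First-step (harmonicity) identity of the extension** off the absorbing set (data bounded on
`S`): `H(ζ)` is the six-neighbour `G`-mean `triSubgraphMean G H ζ` of `TiltedExplorer.lean` —
"discrete harmonic at the undetermined faces". [cite: SchrammSheffield2005, §2 (definition of HE)] -/
theorem triHitExtension_of_not_mem (hG : G ≤ triGraph) {data : Site 2 → ℝ} {M : ℝ}
    (hM : ∀ u ∈ S, |data u| ≤ M) (hζ : ζ ∉ S) :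
    triHitExtension G S data ζ = triSubgraphMean G (triHitExtension G S data) ζ := by
  have hterm : ∀ u, triHitKernel G S ζ u * data u =
      (1 / 6 : ℝ) * ∑ ζ' ∈ triGraph.neighborFinset ζ,
        (if G.Adj ζ ζ' then triHitKernel G S ζ' u * data u else 0) := by
    intro u
    rw [triHitKernel_of_not_mem hG hζ u, mul_assoc, Finset.sum_mul]
    refine congrArg ((1 / 6 : ℝ) * ·) (Finset.sum_congr rfl fun ζ' _ => ?_)
    split_ifs
    · rfl
    · exact zero_mul _
  unfold triHitExtension triSubgraphMean
  rw [tsum_congr hterm, tsum_mul_left, Summable.tsum_finsetSum]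
  · refine congrArg ((1 / 6 : ℝ) * ·) (Finset.sum_congr rfl fun ζ' _ => ?_)
    by_cases h : G.Adj ζ ζ' <;> simp [h]
  · intro ζ' _
    by_cases h : G.Adj ζ ζ'
    · simp only [h, if_true]; exact summable_triHitKernel_mul hG hM ζ'
    · simp only [h, if_false]; exact summable_zero

/-- **The absorbed extension solves the Dirichlet problem** of `TiltedExplorer.lean`: it is a
`IsTriHarmonicExtension G Sᶜ data` (data on `S`, harmonic on the undetermined set `Sᶜ`), for data
bounded on `S`. [cite: SchrammSheffield2005, §2 (definition of HE)] -/
theorem isTriHarmonicExtension_triHitExtension (hG : G ≤ triGraph) {data : Site 2 → ℝ} {M : ℝ}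
    (hM : ∀ u ∈ S, |data u| ≤ M) : IsTriHarmonicExtension G Sᶜ data (triHitExtension G S data) :=
  ⟨fun _ hw => triHitExtension_of_mem data (not_not.1 hw),
    fun _ hw => triHitExtension_of_not_mem hG hM hw⟩

/-- Linearity in the data (for data bounded on `S`). [folklore] -/
theorem triHitExtension_sub (hG : G ≤ triGraph) {d₁ d₂ : Site 2 → ℝ} {M₁ M₂ : ℝ}
    (h₁ : ∀ u ∈ S, |d₁ u| ≤ M₁) (h₂ : ∀ u ∈ S, |d₂ u| ≤ M₂) (ζ : Site 2) :
    triHitExtension G S d₁ ζ - triHitExtension G S d₂ ζ =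
      triHitExtension G S (fun u => d₁ u - d₂ u) ζ := by
  unfold triHitExtension
  rw [← (summable_triHitKernel_mul hG h₁ ζ).tsum_sub (summable_triHitKernel_mul hG h₂ ζ)]
  exact tsum_congr fun u => by ring

/-- A bound on `arcs ∪ T` for data bounded on `arcs`, `T` finite. [folklore] -/
theorem exists_abs_le_on_union {arcs T : Set (Site 2)} (hT : T.Finite) {data : Site 2 → ℝ} {B : ℝ}
    (hB : ∀ u ∈ arcs, |data u| ≤ B) : ∃ M, 0 ≤ M ∧ ∀ u ∈ arcs ∪ T, |data u| ≤ M := by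
  obtain ⟨s, rfl⟩ := hT.exists_finset_coe
  refine ⟨max B 0 + ∑ v ∈ s, |data v|,
    add_nonneg (le_max_right _ _) (Finset.sum_nonneg fun _ _ => abs_nonneg _), ?_⟩
  rintro u (hu | hu)
  · exact (hB u hu).trans ((le_max_left _ _).trans
      (le_add_of_nonneg_right (Finset.sum_nonneg fun _ _ => abs_nonneg _)))
  · exact (Finset.single_le_sum (fun v _ => abs_nonneg (data v)) (Finset.mem_coe.1 hu)).trans
      (le_add_of_nonneg_left (le_max_right _ _))

end RealKernel

/-! ### Geometry of a hexagonal exploration prefix: passed hexagons, sides, turns, angles -/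

/-- The hexagons (sites of `𝕋`) PASSED by the darts `i < n` of the face sequence `P`: the endpoints
of the crossed edges `hexFaceVertices (P i) ∩ hexFaceVertices (P (i+1))`, `i < n`. [folklore] -/
def passedHexagons (P : ℕ → HexVertex) (n : ℕ) : Set (Site 2) :=
  {u | ∃ i < n, u ∈ hexFaceVertices (P i) ∧ u ∈ hexFaceVertices (P (i + 1))}

/-- The index of the FIRST dart of `P` passing the hexagon `u` (`sInf`, junk value `0` if `u` is
never passed). [folklore] -/
def firstPassage (P : ℕ → HexVertex) (u : Site 2) : ℕ :=
  sInf {i : ℕ | u ∈ hexFaceVertices (P i) ∧ u ∈ hexFaceVertices (P (i + 1))}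

/-- The hexagon `u` lies on the LEFT of the dart `i : P i → P (i+1)`: some dart `e = (u → y)` of
`𝕋` has left face `P (i+1)` and right face `P i` (the side convention of
`Literature.Probability.LatticeModels.IsExplorationStep`). [folklore] -/
def IsLeftOfDart (P : ℕ → HexVertex) (i : ℕ) (u : Site 2) : Prop :=
  ∃ e : triGraph.Dart, triEdgeFaces e = (P (i + 1), P i) ∧ e.fst = u

/-- The TURN of the face sequence at its `j`-th face: the sign of
`Im ((c_{j+1} - c_j) · conj (c_j - c_{j-1}))`, `c_j = hexCenter (P j)` — `+1` for a left
(counter-clockwise) turn, `-1` for a right turn (`0` at `j = 0`, by `ℕ`-subtraction, and for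
degenerate steps). [folklore] -/
def hexPathTurn (P : ℕ → HexVertex) (j : ℕ) : ℝ :=
  Real.sign ((hexCenter (P (j + 1)) - hexCenter (P j)) *
    (starRingEnd ℂ) (hexCenter (P j) - hexCenter (P (j - 1)))).im

/-- The GAUGE ANCHOR of the route: the representative of the angle `φ` modulo `2π` closest to the
target `τ = π (∑_{u ∈ crossed edge} β u)/2 + π/2` read off the boundary data on the first crossed
edge `hexFaceVertices f₀ ∩ hexFaceVertices f₁`: `φ + 2π · round ((τ - φ)/(2π))`
(`tiltedExplorerInitAngle β f₀ f₁` is `gaugeAnchor β f₀ f₁ (arg (c₁ - c₀))`). [folklore] -/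
def gaugeAnchor (β : Site 2 → ℝ) (f₀ f₁ : HexVertex) (φ : ℝ) : ℝ :=
  let τ : ℝ := Real.pi * (∑ u ∈ hexFaceVertices f₀ ∩ hexFaceVertices f₁, β u) / 2 + Real.pi / 2
  φ + 2 * Real.pi * (round ((τ - φ) / (2 * Real.pi)) : ℝ)

/-- The unwrapped absolute ANGLE OF THE DART `i` of `P`:
`A_i = A_0 + (π/3) ∑_{j=1}^{i} turn_j`, `A_0 = tiltedExplorerInitAngle β (P 0) (P 1)` the anchored
branch of `arg (c_1 - c_0)` (consecutive darts of a honeycomb path differ by `±π/3`). [folklore] -/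
def dartAngle (β : Site 2 → ℝ) (P : ℕ → HexVertex) (i : ℕ) : ℝ :=
  tiltedExplorerInitAngle β (P 0) (P 1) + Real.pi / 3 * ∑ j ∈ Icc 1 i, hexPathTurn P j

/-- The raw (principal-value) angle of the DISPLACEMENT VECTOR of the window of `m` darts ending
with the dart `i`: `arg (c_{i+1} - c_{i+1-m})` (shorter window `c_{i+1} - c_0` while `i + 1 < m`).
[folklore] -/
def windowRawAngle (P : ℕ → HexVertex) (m i : ℕ) : ℝ :=
  Complex.arg (hexCenter (P (i + 1)) - hexCenter (P (i + 1 - m)))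

/-- The UNWRAPPED WINDOW ANGLE `Â_m(i)`: the raw window angle at `i = 0` anchored in the route gauge,
plus the principal values (in `(-π, π]`) of the increments of consecutive raw window angles along
the path. For `m = 1` the window is the dart itself. [folklore] -/
def windowAngle (β : Site 2 → ℝ) (P : ℕ → HexVertex) (m i : ℕ) : ℝ :=
  gaugeAnchor β (P 0) (P 1) (windowRawAngle P m 0) +
    ∑ j ∈ Icc 1 i, ((windowRawAngle P m j - windowRawAngle P m (j - 1) : ℝ) : Real.Angle).toReal

/-! ### The two bank rules and the functional -/

open scoped Classical in
/-- **First-passage bank data** (variant (a), the exact martingale data of `tiltedExplorerMeasure`):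
`β` on the two discrete arcs; a bank hexagon `u` first passed by the dart `i₀ = firstPassage P u`
carries `c · k_abs(i₀) ∓ g`, `k_abs(i) = (A_i - π/2)/(π/3)`, with the sign `-` iff `u` is on the
LEFT of that dart (so a hexagon examined at entering angle `A` and kept on the left, `A_{i₀} = A - π/3`,
carries `tiltedBankLeft c g A`, and `tiltedBankRight c g A` on the right). [folklore] -/
def latticeFlowLineData (E : DiscreteDobrushin) (β : Site 2 → ℝ) (c g : ℝ) (P : ℕ → HexVertex) :
    Site 2 → ℝ := fun u =>
  if u ∈ E.triArcA ∪ E.triArcB then β u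
  else c * ((dartAngle β P (firstPassage P u) - Real.pi / 2) / (Real.pi / 3)) +
    (if IsLeftOfDart P (firstPassage P u) u then -g else g)

open scoped Classical in
/-- **Mesoscopic-window bank data** (variant (b), texture-free, for `HarmonicWindingPassage`):
as `latticeFlowLineData` with the dart angle `A_{i₀}` replaced by the unwrapped window angle
`Â_m(i₀)` of the displacement over the `m` darts ending with the first passing dart. [folklore] -/
def latticeFlowLineWindowData (E : DiscreteDobrushin) (β : Site 2 → ℝ) (c g : ℝ) (m : ℕ)
    (P : ℕ → HexVertex) : Site 2 → ℝ := fun u =>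
  if u ∈ E.triArcA ∪ E.triArcB then β u
  else c * ((windowAngle β P m (firstPassage P u) - Real.pi / 2) / (Real.pi / 3)) +
    (if IsLeftOfDart P (firstPassage P u) u then -g else g)

/-- The ABSORBING SET after `n` darts: the two discrete arcs and the hexagons passed so far. [folklore] -/
def flowLineAbsorbing (E : DiscreteDobrushin) (P : ℕ → HexVertex) (n : ℕ) : Set (Site 2) :=
  E.triArcA ∪ E.triArcB ∪ passedHexagons P n

/-- **The lattice flow-line harmonic functional, first-passage rule**:
`H n P ζ = ∑_u ∑_{p : ζ → u in Ω_δ, first hit of arcs ∪ passed hexagons at u} (1/6)^{|p|} data(u)`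
with `data = latticeFlowLineData E β c g P`. [folklore] -/
def latticeFlowLineHarmonic (E : DiscreteDobrushin) (β : Site 2 → ℝ) (c g : ℝ) (n : ℕ)
    (P : ℕ → HexVertex) (ζ : Site 2) : ℝ :=
  triHitExtension (triDiscreteDomainGraph E.Ω E.δ) (flowLineAbsorbing E P n)
    (latticeFlowLineData E β c g P) ζ

/-- **The lattice flow-line harmonic functional, mesoscopic-window rule** (window `m`). [folklore] -/
def latticeFlowLineHarmonicWindow (E : DiscreteDobrushin) (β : Site 2 → ℝ) (c g : ℝ) (m n : ℕ)
    (P : ℕ → HexVertex) (ζ : Site 2) : ℝ :=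
  triHitExtension (triDiscreteDomainGraph E.Ω E.δ) (flowLineAbsorbing E P n)
    (latticeFlowLineWindowData E β c g m P) ζ

/-! ### API of the explorer functional -/

section Explorer

variable (E : DiscreteDobrushin) (β : Site 2 → ℝ) (c g : ℝ) (P : ℕ → HexVertex)

/-- `Ω_δ ≤ 𝕋`. [folklore] -/
theorem triDiscreteDomainGraph_le_triGraph (Ω : Set ℂ) (δ : ℝ) : triDiscreteDomainGraph Ω δ ≤ triGraph :=
  (triDiscreteDomainGraph_le_triMeshGraph Ω δ).trans (triMeshGraph_le_triGraph Ω δ)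

/-- The route gauge: `tiltedExplorerInitAngle` is the anchored branch of `arg (c₁ - c₀)`. [folklore] -/
theorem tiltedExplorerInitAngle_eq_gaugeAnchor (f₀ f₁ : HexVertex) :
    tiltedExplorerInitAngle β f₀ f₁ =
      gaugeAnchor β f₀ f₁ (Complex.arg (hexCenter f₁ - hexCenter f₀)) := rfl

/-- `A_0` is the anchored initial angle. [folklore] -/
theorem dartAngle_zero : dartAngle β P 0 = tiltedExplorerInitAngle β (P 0) (P 1) := by
  simp [dartAngle]

/-- `A_{i+1} = A_i + (π/3) turn_{i+1}`. [folklore] -/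
theorem dartAngle_succ (i : ℕ) :
    dartAngle β P (i + 1) = dartAngle β P i + Real.pi / 3 * hexPathTurn P (i + 1) := by
  simp only [dartAngle, Finset.sum_Icc_succ_top (Nat.le_add_left 1 i)]
  ring

/-- `Â_m(0)` is the anchored raw window angle. [folklore] -/
theorem windowAngle_zero (m : ℕ) :
    windowAngle β P m 0 = gaugeAnchor β (P 0) (P 1) (windowRawAngle P m 0) := by
  simp [windowAngle]

/-- `Â_m(i+1) = Â_m(i) + pv (φ_m(i+1) - φ_m(i))`, `pv` the principal value in `(-π, π]`. [folklore] -/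
theorem windowAngle_succ (m i : ℕ) :
    windowAngle β P m (i + 1) = windowAngle β P m i +
      ((windowRawAngle P m (i + 1) - windowRawAngle P m i : ℝ) : Real.Angle).toReal := by
  simp only [windowAngle, Finset.sum_Icc_succ_top (Nat.le_add_left 1 i), Nat.add_sub_cancel]
  ring

/-- The unwrapped window angle moves by at most `π` per dart. [folklore] -/
theorem abs_windowAngle_succ_sub_le (m i : ℕ) :
    |windowAngle β P m (i + 1) - windowAngle β P m i| ≤ Real.pi := by
  rw [windowAngle_succ, add_sub_cancel_left]
  exact Real.Angle.abs_toReal_le_pi _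

/-- For a genuine window (`m ≥ 1`) the two angles share the anchor: `Â_m(0) = A_0`. [folklore] -/
theorem windowAngle_zero_of_pos {m : ℕ} (hm : 0 < m) : windowAngle β P m 0 = dartAngle β P 0 := by
  rw [windowAngle_zero, dartAngle_zero, tiltedExplorerInitAngle_eq_gaugeAnchor, windowRawAngle,
    zero_add, Nat.sub_eq_zero_of_le hm]

/-- No hexagon is passed before the first dart. [folklore] -/
theorem passedHexagons_zero : passedHexagons P 0 = ∅ := by
  ext u; simp [passedHexagons]

/-- The passed set grows along the path. [folklore] -/
theorem passedHexagons_mono {n n' : ℕ} (h : n ≤ n') : passedHexagons P n ⊆ passedHexagons P n' :=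
  fun _ ⟨i, hi, hu⟩ => ⟨i, lt_of_lt_of_le hi h, hu⟩

/-- One more dart passes exactly the two hexagons of the newly crossed edge. [folklore] -/
theorem passedHexagons_succ (n : ℕ) :
    passedHexagons P (n + 1) = passedHexagons P n ∪
      {u | u ∈ hexFaceVertices (P n) ∧ u ∈ hexFaceVertices (P (n + 1))} := by
  ext u
  simp only [passedHexagons, Set.mem_setOf_eq, Set.mem_union]
  constructor
  · rintro ⟨i, hi, hu⟩
    rcases Nat.lt_succ_iff_lt_or_eq.1 hi with hi | rfl
    · exact Or.inl ⟨i, hi, hu⟩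
    · exact Or.inr hu
  · rintro (⟨i, hi, hu⟩ | hu)
    · exact ⟨i, Nat.lt_succ_of_lt hi, hu⟩
    · exact ⟨n, Nat.lt_succ_self n, hu⟩

/-- Finitely many hexagons are passed by finitely many darts. [folklore] -/
theorem passedHexagons_finite (n : ℕ) : (passedHexagons P n).Finite :=
  (((Finset.range n : Set ℕ).toFinite).biUnion fun i _ => (hexFaceVertices (P i)).finite_toSet).subset
    fun _ ⟨_, hi, hu, _⟩ => Set.mem_biUnion (Finset.mem_coe.2 (Finset.mem_range.2 hi)) hu

/-- The first passing dart of a passed hexagon passes it, and comes before `n`. [folklore] -/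
theorem firstPassage_spec {n : ℕ} {u : Site 2} (h : u ∈ passedHexagons P n) :
    firstPassage P u < n ∧ u ∈ hexFaceVertices (P (firstPassage P u)) ∧
      u ∈ hexFaceVertices (P (firstPassage P u + 1)) := by
  obtain ⟨i, hi, hu⟩ := h
  have hne : ({i : ℕ | u ∈ hexFaceVertices (P i) ∧ u ∈ hexFaceVertices (P (i + 1))} : Set ℕ).Nonempty :=
    ⟨i, hu⟩
  exact ⟨lt_of_le_of_lt (Nat.sInf_le hu) hi, Nat.sInf_mem hne⟩

/-- The first passage index is at most any passing index. [folklore] -/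
theorem firstPassage_le {i : ℕ} {u : Site 2}
    (hu : u ∈ hexFaceVertices (P i) ∧ u ∈ hexFaceVertices (P (i + 1))) : firstPassage P u ≤ i :=
  Nat.sInf_le hu

/-- The absorbing set grows along the path. [folklore] -/
theorem flowLineAbsorbing_mono {n n' : ℕ} (h : n ≤ n') :
    flowLineAbsorbing E P n ⊆ flowLineAbsorbing E P n' :=
  Set.union_subset_union_right _ (passedHexagons_mono P h)

/-- The arcs are absorbing. [folklore] -/
theorem subset_flowLineAbsorbing (n : ℕ) : E.triArcA ∪ E.triArcB ⊆ flowLineAbsorbing E P n :=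
  Set.subset_union_left

/-- On the arcs both bank rules return the boundary data `β`. [folklore] -/
theorem latticeFlowLineData_of_mem_arcs {u : Site 2} (hu : u ∈ E.triArcA ∪ E.triArcB) :
    latticeFlowLineData E β c g P u = β u := by
  unfold latticeFlowLineData; rw [if_pos hu]

/-- On the arcs both bank rules return the boundary data `β`. [folklore] -/
theorem latticeFlowLineWindowData_of_mem_arcs (m : ℕ) {u : Site 2} (hu : u ∈ E.triArcA ∪ E.triArcB) :
    latticeFlowLineWindowData E β c g m P u = β u := by
  unfold latticeFlowLineWindowData; rw [if_pos hu]

/-- First-passage rule, LEFT bank: `c k_abs(i₀) - g`. [folklore] -/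
theorem latticeFlowLineData_of_left {u : Site 2} (hu : u ∉ E.triArcA ∪ E.triArcB)
    (hL : IsLeftOfDart P (firstPassage P u) u) :
    latticeFlowLineData E β c g P u =
      c * ((dartAngle β P (firstPassage P u) - Real.pi / 2) / (Real.pi / 3)) - g := by
  unfold latticeFlowLineData; rw [if_neg hu, if_pos hL]; ring

/-- First-passage rule, RIGHT bank: `c k_abs(i₀) + g`. [folklore] -/
theorem latticeFlowLineData_of_not_left {u : Site 2} (hu : u ∉ E.triArcA ∪ E.triArcB)
    (hR : ¬ IsLeftOfDart P (firstPassage P u) u) :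
    latticeFlowLineData E β c g P u =
      c * ((dartAngle β P (firstPassage P u) - Real.pi / 2) / (Real.pi / 3)) + g := by
  unfold latticeFlowLineData; rw [if_neg hu, if_neg hR]

/-- **Consistency with the tilted explorer's frozen values, left bank**: a hexagon kept on the
LEFT of its first passing dart, which was entered from a dart of angle `A` (so `A_{i₀} = A - π/3`,
the path turned right), carries `tiltedBankLeft c g A`. [cite: SchrammSheffield2005, §2 (definition of HE)] -/
theorem latticeFlowLineData_eq_tiltedBankLeft {u : Site 2} {A : ℝ} (hu : u ∉ E.triArcA ∪ E.triArcB)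
    (hL : IsLeftOfDart P (firstPassage P u) u) (hA : dartAngle β P (firstPassage P u) = A - Real.pi / 3) :
    latticeFlowLineData E β c g P u = tiltedBankLeft c g A := by
  rw [latticeFlowLineData_of_left E β c g P hu hL, hA, tiltedBankLeft]
  ring

/-- **Consistency with the tilted explorer's frozen values, right bank**: a hexagon on the RIGHT
of its first passing dart (`A_{i₀} = A + π/3`, the path turned left) carries `tiltedBankRight c g A`.
[cite: SchrammSheffield2005, §2 (definition of HE)] -/
theorem latticeFlowLineData_eq_tiltedBankRight {u : Site 2} {A : ℝ} (hu : u ∉ E.triArcA ∪ E.triArcB)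
    (hR : ¬ IsLeftOfDart P (firstPassage P u) u)
    (hA : dartAngle β P (firstPassage P u) = A + Real.pi / 3) :
    latticeFlowLineData E β c g P u = tiltedBankRight c g A := by
  rw [latticeFlowLineData_of_not_left E β c g P hu hR, hA, tiltedBankRight]
  ring

open scoped Classical in
/-- **Agreement of the two bank rules up to the window correction**: the data differ exactly by
`c (Â_m(i₀) - A_{i₀})/(π/3)` on bank hexagons and agree on the arcs. [folklore] -/
theorem latticeFlowLineWindowData_sub (m : ℕ) (u : Site 2) :
    latticeFlowLineWindowData E β c g m P u - latticeFlowLineData E β c g P u =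
      if u ∈ E.triArcA ∪ E.triArcB then 0 else
        c * ((windowAngle β P m (firstPassage P u) - dartAngle β P (firstPassage P u)) /
          (Real.pi / 3)) := by
  unfold latticeFlowLineWindowData latticeFlowLineData
  split_ifs <;> ring

/-- The first-passage data are bounded on the absorbing set as soon as `β` is bounded on the
arcs (finitely many bank hexagons). [folklore] -/
theorem exists_abs_latticeFlowLineData_le {B : ℝ} (hβ : ∀ u ∈ E.triArcA ∪ E.triArcB, |β u| ≤ B)
    (n : ℕ) : ∃ M, 0 ≤ M ∧ ∀ u ∈ flowLineAbsorbing E P n, |latticeFlowLineData E β c g P u| ≤ M :=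
  exists_abs_le_on_union (passedHexagons_finite P n) fun u hu => by
    rw [latticeFlowLineData_of_mem_arcs E β c g P hu]; exact hβ u hu

/-- The window data are bounded on the absorbing set as soon as `β` is bounded on the arcs.
[folklore] -/
theorem exists_abs_latticeFlowLineWindowData_le {B : ℝ}
    (hβ : ∀ u ∈ E.triArcA ∪ E.triArcB, |β u| ≤ B) (m n : ℕ) :
    ∃ M, 0 ≤ M ∧ ∀ u ∈ flowLineAbsorbing E P n, |latticeFlowLineWindowData E β c g m P u| ≤ M :=
  exists_abs_le_on_union (passedHexagons_finite P n) fun u hu => by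
    rw [latticeFlowLineWindowData_of_mem_arcs E β c g P m hu]; exact hβ u hu

/-- **Boundary values of `H`**: on the absorbing set `H n P ζ = data(ζ)`. [folklore] -/
theorem latticeFlowLineHarmonic_of_mem {n : ℕ} {ζ : Site 2} (hζ : ζ ∈ flowLineAbsorbing E P n) :
    latticeFlowLineHarmonic E β c g n P ζ = latticeFlowLineData E β c g P ζ :=
  triHitExtension_of_mem _ hζ

/-- On the arcs `H = β`. [folklore] -/
theorem latticeFlowLineHarmonic_of_mem_arcs (n : ℕ) {ζ : Site 2} (hζ : ζ ∈ E.triArcA ∪ E.triArcB) :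
    latticeFlowLineHarmonic E β c g n P ζ = β ζ := by
  rw [latticeFlowLineHarmonic_of_mem E β c g P (subset_flowLineAbsorbing E P n hζ),
    latticeFlowLineData_of_mem_arcs E β c g P hζ]

/-- **Boundary values of `Ĥ`** (window rule). [folklore] -/
theorem latticeFlowLineHarmonicWindow_of_mem (m : ℕ) {n : ℕ} {ζ : Site 2}
    (hζ : ζ ∈ flowLineAbsorbing E P n) :
    latticeFlowLineHarmonicWindow E β c g m n P ζ = latticeFlowLineWindowData E β c g m P ζ :=
  triHitExtension_of_mem _ hζ

open scoped Classical in
/-- **Harmonicity of `H` off the absorbing set** (the first-step identity in `ζ`): for `ζ` not on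
an arc and not yet passed, `H n P ζ` is the six-neighbour `Ω_δ`-mean of `H n P`. [cite: SchrammSheffield2005, §2 (definition of HE)] -/
theorem latticeFlowLineHarmonic_of_not_mem {B : ℝ} (hβ : ∀ u ∈ E.triArcA ∪ E.triArcB, |β u| ≤ B)
    {n : ℕ} {ζ : Site 2} (hζ : ζ ∉ flowLineAbsorbing E P n) :
    latticeFlowLineHarmonic E β c g n P ζ =
      triSubgraphMean (triDiscreteDomainGraph E.Ω E.δ) (latticeFlowLineHarmonic E β c g n P) ζ := by
  obtain ⟨M, -, hM⟩ := exists_abs_latticeFlowLineData_le E β c g P hβ n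
  exact triHitExtension_of_not_mem (triDiscreteDomainGraph_le_triGraph E.Ω E.δ) hM hζ

/-- **`H n P` solves the Dirichlet problem** with data `latticeFlowLineData` on the absorbing set
(undetermined set = its complement). [cite: SchrammSheffield2005, §2 (definition of HE)] -/
theorem isTriHarmonicExtension_latticeFlowLineHarmonic {B : ℝ}
    (hβ : ∀ u ∈ E.triArcA ∪ E.triArcB, |β u| ≤ B) (n : ℕ) :
    IsTriHarmonicExtension (triDiscreteDomainGraph E.Ω E.δ) (flowLineAbsorbing E P n)ᶜ
      (latticeFlowLineData E β c g P) (latticeFlowLineHarmonic E β c g n P) := by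
  obtain ⟨M, -, hM⟩ := exists_abs_latticeFlowLineData_le E β c g P hβ n
  exact isTriHarmonicExtension_triHitExtension (triDiscreteDomainGraph_le_triGraph E.Ω E.δ) hM

/-- **`Ĥ` solves the Dirichlet problem** with the window data. [cite: SchrammSheffield2005, §2 (definition of HE)] -/
theorem isTriHarmonicExtension_latticeFlowLineHarmonicWindow {B : ℝ}
    (hβ : ∀ u ∈ E.triArcA ∪ E.triArcB, |β u| ≤ B) (m n : ℕ) :
    IsTriHarmonicExtension (triDiscreteDomainGraph E.Ω E.δ) (flowLineAbsorbing E P n)ᶜ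
      (latticeFlowLineWindowData E β c g m P) (latticeFlowLineHarmonicWindow E β c g m n P) := by
  obtain ⟨M, -, hM⟩ := exists_abs_latticeFlowLineWindowData_le E β c g P hβ m n
  exact isTriHarmonicExtension_triHitExtension (triDiscreteDomainGraph_le_triGraph E.Ω E.δ) hM

/-- **Boundedness by `max |data|`**: `|H n P ζ| ≤ M` whenever `|data| ≤ M` on the absorbing set.
[folklore] -/
theorem abs_latticeFlowLineHarmonic_le {n : ℕ} {M : ℝ} (hM0 : 0 ≤ M)
    (hM : ∀ u ∈ flowLineAbsorbing E P n, |latticeFlowLineData E β c g P u| ≤ M) (ζ : Site 2) :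
    |latticeFlowLineHarmonic E β c g n P ζ| ≤ M :=
  abs_triHitExtension_le (triDiscreteDomainGraph_le_triGraph E.Ω E.δ) hM0 hM ζ

/-- **Boundedness of `Ĥ`**. [folklore] -/
theorem abs_latticeFlowLineHarmonicWindow_le {m n : ℕ} {M : ℝ} (hM0 : 0 ≤ M)
    (hM : ∀ u ∈ flowLineAbsorbing E P n, |latticeFlowLineWindowData E β c g m P u| ≤ M)
    (ζ : Site 2) : |latticeFlowLineHarmonicWindow E β c g m n P ζ| ≤ M :=
  abs_triHitExtension_le (triDiscreteDomainGraph_le_triGraph E.Ω E.δ) hM0 hM ζ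

/-- **Monotonicity of the arcs' (and old banks') harmonic measure under adding banks**: seen from
any hexagon, the first-hit probability of an already absorbing site can only decrease as the path
grows. [folklore] -/
theorem triHitKernel_flowLineAbsorbing_anti {n n' : ℕ} (h : n ≤ n') {u : Site 2}
    (hu : u ∈ flowLineAbsorbing E P n) (ζ : Site 2) :
    triHitKernel (triDiscreteDomainGraph E.Ω E.δ) (flowLineAbsorbing E P n') ζ u ≤
      triHitKernel (triDiscreteDomainGraph E.Ω E.δ) (flowLineAbsorbing E P n) ζ u :=
  triHitKernel_anti (triDiscreteDomainGraph_le_triGraph E.Ω E.δ) (flowLineAbsorbing_mono E P h) hu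

open scoped Classical in
/-- **Agreement of the two functionals up to the window correction**: `Ĥ - H` is the absorbed
extension of the bank correction `c (Â_m(i₀) - A_{i₀})/(π/3)` (zero on the arcs). [folklore] -/
theorem latticeFlowLineHarmonicWindow_sub {B : ℝ} (hβ : ∀ u ∈ E.triArcA ∪ E.triArcB, |β u| ≤ B)
    (m n : ℕ) (ζ : Site 2) :
    latticeFlowLineHarmonicWindow E β c g m n P ζ - latticeFlowLineHarmonic E β c g n P ζ =
      triHitExtension (triDiscreteDomainGraph E.Ω E.δ) (flowLineAbsorbing E P n)
        (fun u => if u ∈ E.triArcA ∪ E.triArcB then 0 else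
          c * ((windowAngle β P m (firstPassage P u) - dartAngle β P (firstPassage P u)) /
            (Real.pi / 3))) ζ := by
  obtain ⟨M₁, -, h₁⟩ := exists_abs_latticeFlowLineWindowData_le E β c g P hβ m n
  obtain ⟨M₂, -, h₂⟩ := exists_abs_latticeFlowLineData_le E β c g P hβ n
  unfold latticeFlowLineHarmonicWindow latticeFlowLineHarmonic
  rw [triHitExtension_sub (triDiscreteDomainGraph_le_triGraph E.Ω E.δ) h₁ h₂]
  refine congrArg (fun d => triHitExtension _ _ d ζ) (funext fun u => ?_)
  exact latticeFlowLineWindowData_sub E β c g P m u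

end Explorer

end Literature.Probability.RandomPlanarGeometry

end
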